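import Summits.ABC.IUTFork.Repair.RHHullThresholdExact
import HarnessLib

/-!
# R-W «W:REF-BANDS-EXACT»: the top-label hull-threshold cell at an EXACT tame local type FAILS by ONE LINEAR integer inequality
# (closed form of the refuted-side band certificate; pure integer arithmetic)

PROOF-ONLY file (D-0012: 0 definitions, 0 `Prop` facts, no instance, no notation) of the abc-iut cell — D-0079 RESCUE sub-cell R-W «WINDOW
Θ-SIDE INEQUALITY», numerics-crew seat abc-iut-W-num-6 (gen 4), row «W:REF-BANDS-EXACT» (abc-iut-plan g11 C-R83 (c) / C-R84 (b): the REFUTED side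
of the window at the EXACT genuine local type `e = e_v·l`, uniform in the level `l`). TAKES NO SIDE on [IUTchIII] Cor. 3.12 (S. Mochizuki,
*Inter-universal Teichmüller theory III*, RIMS manuscript, Cor. 3.12 p. 173–174, Step (xi-f) p. 184) or on any author: this file is integer
arithmetic about R-H row 4's closed-form column `Summit.ABC.IUTFork.Repair.RH.HullThresholdExact.HullCell` (abc-iut-rh-typ-4, p458452), the
integer input `hneg`/`hcell` of the refuted-side engines (abc-iut-rh-typ-4 `RH.HullThresholdExactRefute.not_licence_settingPrVolSharp_of_not_hullCell`
p462895, `Conditional/HexHullThresholdGenuine` p473071; abc-iut-w4-d094 `Conditional/HullThresholdCellFailRefute` p491719).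

WHAT. The R-W numerics lead's certificate file HOME/plan/rescue/R-W/REF-BANDS-EXACT-CERTS.tsv (sha16 368bd85925fe47bb, tools/ref_bands_exact.py)
decides the top-label cell at a tame pole `p` (`p ∤ e`, different exponent `e − 1`, inner exponent `⌊e/(p−1)⌋ + 1`, outer exponent
`p^{a} − a·e` on the piece where `a` is the turning point, q-degree `P = e_v·v`, local type `e = e_v·l`, label `j = l⋆ = (l−1)/2`) by the sign of
`g := P·j² − j(e−1) − (j+1)(⌊e/(p−1)⌋+1) − (e−1) + (j+1)(p^a − a·e) − P` (since `e·⌊X/e⌋ ≥ X − (e−1)`). This seat's second engine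
(HOME/abc-iut-W-num-6/refbands/closed_forms.py, CLOSED-FORMS.tsv sha16 99ddd185748614fe; 2,385,320 evaluations against the lead's formula, 0
mismatches) found that `g` FACTORS:
  `g = (j+1)·(α·j + β − ⌊e_v·l/(p−1)⌋)`, `α = e_v·(v − 2 − 2a)`, `β = p^a − e_v·(1 + a + v)`,
and since `α·j + β` is an integer, `g > 0 ⟺ e_v·l < (p−1)·(α·j + β)` — ONE LINEAR inequality in `l` per piece, no floor and no quadratic.
* `RefBand.mul_ediv_ge` — `e·⌊X/e⌋ ≥ X − (e − 1)` (`0 < e`);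
* `RefBand.not_hullCell_of_linear` — the cell FAILS at `(e, m, j, r_in, r_out) = (e_v·l, e_v·v, j, e_v·l/(p−1) + 1, pa − a·e)` with `l = 2j+1`
  as soon as `e_v·l < (p−1)·(e_v(v−2−2a)·j + (pa − e_v(1+a+v)))` (`pa` stands for `p^a`; the lemma does not need that, any integer `pa` works);
* `RefBand.not_hullCell_of_linear'` — the same with the bound spelled in `l` only: `2·e_v·l < (p−1)·(e_v(v−2−2a)·(l−1) + 2(pa − e_v(1+a+v)))`.
Every tame a₀-piece of every «REF-BANDS-EXACT» datum band is this lemma plus `omega` on the piece's `l`-range (e.g. the 1061-triple at `p = 1061`,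
`e_v = 15`, `v = 4`: piece `a = 1`, `pa = 1061`: `30·l < 2058520`, i.e. every `l ≤ 68617`). HONEST SCOPE: integer bookkeeping only; nothing here
bears on the printed inequality, on the number-level `Cor22.Cor312AtDatum`, or on any typed setting by itself; refuted-as-typed ≠ refuted-in-print;
typed ≠ proved; no abc claim. [folklore] throughout; standard axioms.
-/

namespace Summit.ABC.IUTFork.Conditional

open Summit.ABC.IUTFork.Repair.RH.HullThresholdExact

/-- `e·⌊X/e⌋ ≥ X − (e − 1)` for `0 < e` (integer division). [folklore] -/
theorem RefBand.mul_ediv_ge {e : ℤ} (he : 0 < e) (X : ℤ) : X - (e - 1) ≤ e * (X / e) := by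
  have h1 := Int.emod_add_mul_ediv X e
  have h2 := Int.emod_lt_of_pos X he
  have h3 := Int.emod_nonneg X he.ne'
  linarith

/-- **The closed form of the top-label REF certificate.** With `e = e_v·l`, `m = e_v·v`, `l = 2j + 1`, `r_in = e_v·l/(p−1) + 1`,
`r_out = pa − a·e`: `(j²m − j(e−1) − (j+1)·r_in) − (e−1) − m + (j+1)·r_out = (j+1)·(e_v(v−2−2a)·j + (pa − e_v(1+a+v)) − e_v·l/(p−1))`. [folklore] -/
theorem RefBand.cert_eq_factor (ev v j a pa q : ℤ) :
    (j ^ 2 * (ev * v) - j * (ev * (2 * j + 1) - 1) - (j + 1) * (q + 1)) - (ev * (2 * j + 1) - 1) - ev * v +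
        (j + 1) * (pa - a * (ev * (2 * j + 1))) =
      (j + 1) * (ev * (v - 2 - 2 * a) * j + (pa - ev * (1 + a + v)) - q) := by
  ring

/-- **REF-BANDS-EXACT, tame piece: the top-label hull-threshold cell FAILS by ONE linear inequality.** For integers with `0 < e_v`, `1 < p`,
`0 ≤ j`, `l = 2j + 1`, `e = e_v·l`, `m = e_v·v` and ANY `pa, a` (intended `pa = p^a`, `a` the turning point of `e`): if
`e_v·l < (p − 1)·(e_v(v − 2 − 2a)·j + (pa − e_v(1 + a + v)))` then `¬ HullCell e m j (e_v·l/(p−1) + 1) (pa − a·e)` (R-H row 4's column at the exponents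
`r_in = ⌊e/(p−1)⌋ + 1`, `r_out = p^a − a·e`). Proof: `e⌊X/e⌋ ≥ X − (e−1)`, the factorisation `RefBand.cert_eq_factor`, and `⌊e_v l/(p−1)⌋ < N ⟺ e_v l < N(p−1)`
for the integer `N = α j + β`. [folklore] -/
theorem RefBand.not_hullCell_of_linear {ev v p a pa l j e m : ℤ} (hev : 0 < ev) (hp : 1 < p) (hj : 0 ≤ j) (hl : l = 2 * j + 1)
    (he : e = ev * l) (hm : m = ev * v)
    (hlin : ev * l < (p - 1) * (ev * (v - 2 - 2 * a) * j + (pa - ev * (1 + a + v)))) :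
    ¬ HullCell e m j (ev * l / (p - 1) + 1) (pa - a * e) := by
  intro hc
  unfold HullCell at hc
  have hp1 : 0 < p - 1 := by linarith
  have hl0 : 0 < l := by linarith
  have he0 : 0 < e := by rw [he]; positivity
  set q : ℤ := ev * l / (p - 1) with hq
  set N : ℤ := ev * (v - 2 - 2 * a) * j + (pa - ev * (1 + a + v)) with hN
  -- `q < N` from the linear hypothesis
  have hqN : q < N := by
    rw [hq, Int.ediv_lt_iff_lt_mul hp1]
    linarith [mul_comm (p - 1) N]
  -- the floor bound and the factorisation
  set X : ℤ := j ^ 2 * m - j * (e - 1) - (j + 1) * (q + 1) with hX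
  have hfloor := RefBand.mul_ediv_ge he0 X
  have hfac : X - (e - 1) - m + (j + 1) * (pa - a * e) = (j + 1) * (N - q) := by
    have h := RefBand.cert_eq_factor ev v j a pa q
    rw [hX, hN, he, hm, hl]
    linear_combination h
  have hpos : 1 ≤ (j + 1) * (N - q) := by nlinarith
  -- contradiction with the cell
  have : e * (X / e) ≤ m - (j + 1) * (pa - a * e) := hc
  linarith

/-- **The same with the bound written in `l` alone**: `2·e_v·l < (p − 1)·(e_v(v − 2 − 2a)·(l − 1) + 2·(pa − e_v(1 + a + v)))` (multiply by `2`, `2j = l − 1`).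
This is the column `ineq(A*l<B)` of HOME/abc-iut-W-num-6/refbands/CLOSED-FORMS.tsv rearranged. [folklore] -/
theorem RefBand.not_hullCell_of_linear' {ev v p a pa l j e m : ℤ} (hev : 0 < ev) (hp : 1 < p) (hj : 0 ≤ j) (hl : l = 2 * j + 1)
    (he : e = ev * l) (hm : m = ev * v)
    (hlin : 2 * (ev * l) < (p - 1) * (ev * (v - 2 - 2 * a) * (l - 1) + 2 * (pa - ev * (1 + a + v)))) :
    ¬ HullCell e m j (ev * l / (p - 1) + 1) (pa - a * e) := by
  refine RefBand.not_hullCell_of_linear hev hp hj hl he hm ?_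
  have h2 : (p - 1) * (ev * (v - 2 - 2 * a) * (l - 1) + 2 * (pa - ev * (1 + a + v))) =
      2 * ((p - 1) * (ev * (v - 2 - 2 * a) * j + (pa - ev * (1 + a + v)))) := by
    rw [hl]; ring
  linarith

end Summit.ABC.IUTFork.Conditional
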